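import Literature.AlgebraicGeometry.Motives.GrassmannianPluckerMap
import Literature.AlgebraicGeometry.Motives.GrassmannianChartReflect
import Literature.LinearAlgebra.Alternating.TopExteriorPowerDetectsIso
import HarnessLib

/-!
# The Plücker map and the standard charts: `plucker⁻¹(U_{x₁ ∧ ⋯ ∧ x_k}) = U_x`

Topic `AlgebraicGeometry/Motives`; namespace `Literature.AlgebraicGeometry.Motives.Grassmannian`.  THEOREMS ONLY (no
definition, no instance, no notation, no named fact, no `sorry`); sequel of `Motives/GrassmannianPluckerMap` (`plucker N`,
naturality `map_plucker`).

[GortzWedhorn2020, (8.10), proof of Prop. 8.23 (p. 220): «we see that π(S)⁻¹(P^J(S)) = G^J(S)» (Cor. 8.12: `u` iso iff `⋀ᵈ u` iso)]: for a `k`-frame `x = (x₁, …, x_k)`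
the inverse image of the standard chart `U_{x₁∧⋯∧x_k} ⊂ ℙ(⋀ᵏ ℰ)` (the decomposable `x₁ ∧ ⋯ ∧ x_k` generates the
line-bundle quotient) is the standard chart `U_x ⊂ Grass` (the `xⱼ` generate the rank-`k` quotient); [EisenbudHarris2016, §3.2.2].
On the ring side of the tree's Grassmannian functor (★ `chart R M k x A = {N | frameMap x N bijective}`):

* §1 `range_exteriorPower_map_frameMap`, `surjective_frameMap_plucker_iff` (any `A`): the frame map of `plucker N` at the
  one-element frame `x₁ ∧ ⋯ ∧ x_k` is surjective iff `⋀ᵏ(frameMap x N) : ⋀ᵏ Aᵏ → ⋀ᵏ Q_N` is surjective (both ranges are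
  the span of `[1⊗x₁] ∧ ⋯ ∧ [1⊗x_k]`, ★ `exists_eq_smul_ιMulti_basis`);
* §2 `plucker_mem_chart_iff_of_field` (over a field: ★ `bijective_of_surjective_exteriorPower_map_of_finrank_eq`, the top
  exterior power detects isomorphisms);
* §3 `mem_chart_iff_forall_residueField` (chart membership is tested on residue fields: ★ `map_residueField_mem_chart_iff` +
  Mathlib `Module.support_eq_empty_iff`) and **`plucker_mem_chart_iff (x) (N) :
  plucker N ∈ chart R (⋀[R]^k M) 1 (fun _ => x₁ ∧ ⋯ ∧ x_k) A ↔ N ∈ chart R M k x A`** for EVERY commutative `R`-algebra `A`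
  (naturality ★ `map_plucker` reduces to §2).

Cell `hodgecm-mathlib` (D-0151), F-DAG hand «Plücker» (F-5 (a)); count-neutral Mathlib-side capital; nothing here is about HC —
HC_CM is proved only modulo the 7 printed citations until rung 0 closes.

## References
* [GortzWedhorn2020] U. Görtz, T. Wedhorn, *Algebraic Geometry I*, 2nd ed. (2020), (8.10), Prop. 8.23 and its proof (p. 220) (held text, chunk p0272).
* [EisenbudHarris2016] D. Eisenbud, J. Harris, *3264 and All That* (2016), §3.2.2.
* [StacksProject] The Stacks project, Tag 089T.
* [BourbakiAlgebre1a3] N. Bourbaki, *Algèbre, Ch. 1 à 3*, Ch. III §8 no. 2 Thm. 1 (top exterior power and invertibility).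
-/

set_option autoImplicit false

noncomputable section

universe u v w

open TensorProduct Function
open Literature.LinearAlgebra.Alternating

namespace Literature.AlgebraicGeometry.Motives

namespace Grassmannian

variable {R : Type u} [CommRing R] {M : Type v} [AddCommGroup M] [Module R M] {k : ℕ}
variable {A : Type w} [CommRing A] [Algebra R A]

/-! ## §1 The frame map of the Plücker point vs `⋀ᵏ` of the frame map -/

/-- **The range of `⋀ᵏ(frameMap x N) : ⋀ᵏ_A Aᵏ → ⋀ᵏ_A ((A ⊗ M)⧸N)` is the line spanned by `[1⊗x₁] ∧ ⋯ ∧ [1⊗x_k]`**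
(`⋀ᵏ Aᵏ` is monogenous on `e₁ ∧ ⋯ ∧ e_k`, ★ `exists_eq_smul_ιMulti_basis`, and `frameMap x N eⱼ = [1 ⊗ xⱼ]`).
[cite: GortzWedhorn2020, (8.10) Prop. 8.23 (p. 220)] -/
theorem range_exteriorPower_map_frameMap (x : Fin k → M) (N : Submodule A (A ⊗[R] M)) :
    LinearMap.range (exteriorPower.map k (frameMap x N)) =
      Submodule.span A {exteriorPower.ιMulti A k (fun j => N.mkQ ((1 : A) ⊗ₜ[R] x j))} := by
  have hq : exteriorPower.ιMulti A k (⇑(frameMap x N) ∘ ⇑(Pi.basisFun A (Fin k))) =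
      exteriorPower.ιMulti A k (fun j => N.mkQ ((1 : A) ⊗ₜ[R] x j)) := by
    congr 1
    funext j
    rw [Function.comp_apply, Pi.basisFun_apply, frameMap_single]
  apply le_antisymm
  · rintro _ ⟨w, rfl⟩
    obtain ⟨r, rfl⟩ := exists_eq_smul_ιMulti_basis (Pi.basisFun A (Fin k)) w
    rw [map_smul, exteriorPower.map_apply_ιMulti, hq]
    exact Submodule.smul_mem _ r (Submodule.subset_span rfl)
  · rw [Submodule.span_le, Set.singleton_subset_iff]
    exact ⟨exteriorPower.ιMulti A k (Pi.basisFun A (Fin k)), by rw [exteriorPower.map_apply_ιMulti, hq]⟩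

/-- The range of the frame map of `plucker N` at the one-element frame `x₁ ∧ ⋯ ∧ x_k`, transported along
`(A ⊗ ⋀ᵏM)⧸(plucker N) ≅ ⋀ᵏ_A Q_N` (★ `pluckerQuotEquiv`), is the same line. [cite: GortzWedhorn2020, (8.10) Prop. 8.23 (p. 220)] -/
theorem map_range_frameMap_plucker (x : Fin k → M) (N : Module.Grassmannian A (A ⊗[R] M) k) :
    (LinearMap.range (frameMap (fun _ : Fin 1 => exteriorPower.ιMulti R k x) (plucker N).toSubmodule)).map
        (pluckerQuotEquiv N).toLinearMap =
      Submodule.span A {exteriorPower.ιMulti A k (fun j => N.toSubmodule.mkQ ((1 : A) ⊗ₜ[R] x j))} := by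
  rw [range_frameMap, Submodule.map_span]
  congr 1
  ext z
  simp only [Set.mem_image, Set.mem_range, exists_exists_eq_and, LinearEquiv.coe_coe, Set.mem_singleton_iff]
  constructor
  · rintro ⟨_, rfl⟩
    rw [pluckerQuotEquiv_mk, pluckerLinearMap_one_tmul_ιMulti]
  · rintro rfl
    exact ⟨0, by rw [pluckerQuotEquiv_mk, pluckerLinearMap_one_tmul_ιMulti]⟩

/-- **The frame map of `plucker N` at `x₁ ∧ ⋯ ∧ x_k` is surjective iff `⋀ᵏ(frameMap x N)` is surjective.**
[cite: GortzWedhorn2020, (8.10) Prop. 8.23 (p. 220)] -/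
theorem surjective_frameMap_plucker_iff (x : Fin k → M) (N : Module.Grassmannian A (A ⊗[R] M) k) :
    Surjective (frameMap (fun _ : Fin 1 => exteriorPower.ιMulti R k x) (plucker N).toSubmodule) ↔
      Surjective (exteriorPower.map k (frameMap x N.toSubmodule)) := by
  rw [← LinearMap.range_eq_top, ← LinearMap.range_eq_top, range_exteriorPower_map_frameMap,
    ← map_range_frameMap_plucker x N]
  constructor
  · intro h
    rw [h, Submodule.map_top, LinearMap.range_eq_top]
    exact (pluckerQuotEquiv N).surjective
  · intro h
    apply Submodule.map_injective_of_injective (pluckerQuotEquiv N).injective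
    rw [h, Submodule.map_top, eq_comm, LinearMap.range_eq_top]
    exact (pluckerQuotEquiv N).surjective

/-! ## §2 Over a field -/

/-- Over a field `K`, the rank-`k` quotient `(K ⊗ M)⧸N` of a point `N ∈ G(k, K ⊗ M; K)` has `finrank = k`. [cite: StacksProject, Tag 089R] -/
theorem finrank_quotient_of_field {K : Type w} [Field K] [Algebra R K] (N : Module.Grassmannian K (K ⊗[R] M) k) :
    Module.finrank K ((K ⊗[R] M) ⧸ N.toSubmodule) = k := by
  have h := N.rankAtStalk_eq (Classical.arbitrary (PrimeSpectrum K))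
  rwa [Module.rankAtStalk_eq_finrank_of_free] at h

/-- **Over a field: `plucker N ∈ U_{x₁∧⋯∧x_k} ↔ N ∈ U_x`** — the top exterior power of `Kᵏ → Q_N` is surjective iff the map is
bijective (★ `bijective_of_surjective_exteriorPower_map_of_finrank_eq`, Bourbaki Alg. III §8 no. 2 Thm. 1).
[cite: GortzWedhorn2020, (8.10) Prop. 8.23 (p. 220)] [cite: BourbakiAlgebre1a3, Ch. III §8 no. 2 Thm. 1] -/
theorem plucker_mem_chart_iff_of_field {K : Type w} [Field K] [Algebra R K] (x : Fin k → M)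
    (N : Module.Grassmannian K (K ⊗[R] M) k) :
    plucker N ∈ chart R (⋀[R]^k M) 1 (fun _ => exteriorPower.ιMulti R k x) K ↔ N ∈ chart R M k x K := by
  rw [mem_chart_iff_surjective, surjective_frameMap_plucker_iff, mem_chart_iff]
  exact ⟨fun h => bijective_of_surjective_exteriorPower_map_of_finrank_eq (Module.finrank_fin_fun K)
      (finrank_quotient_of_field N) _ h,
    fun h => (bijective_exteriorPower_map_of_bijective k _ h).2⟩

/-! ## §3 Over any ring, via residue fields -/

/-- **Chart membership is tested on residue fields**: `N ∈ U_x(A) ↔ ∀ 𝔭, N ⊗ κ(𝔭) ∈ U_x(κ(𝔭))` (the cokernel of the frame map is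
a finite module, zero iff its support is empty; ★ `map_residueField_mem_chart_iff`). [cite: StacksProject, Tag 089T] -/
theorem mem_chart_iff_forall_residueField (x : Fin k → M) (N : Module.Grassmannian A (A ⊗[R] M) k) :
    N ∈ chart R M k x A ↔ ∀ p : PrimeSpectrum A,
      Module.Grassmannian.map (IsScalarTower.toAlgHom R A p.asIdeal.ResidueField) N ∈
        chart R M k x p.asIdeal.ResidueField := by
  simp_rw [map_residueField_mem_chart_iff]
  rw [mem_chart_iff_subsingleton_coker, ← Module.support_eq_empty_iff (R := A), Set.eq_empty_iff_forall_notMem]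

/-- **`plucker⁻¹(U_{x₁∧⋯∧x_k}) = U_x` over every commutative `R`-algebra `A`**:
`plucker N ∈ chart R (⋀ᵏ M) 1 (x₁ ∧ ⋯ ∧ x_k) A ↔ N ∈ chart R M k x A` (test on residue fields, §3; transport `plucker` to the
residue field by naturality ★ `map_plucker`; conclude by the field case §2).
[cite: GortzWedhorn2020, (8.10) Prop. 8.23 (p. 220)] [cite: EisenbudHarris2016, §3.2.2] -/
theorem plucker_mem_chart_iff (x : Fin k → M) (N : Module.Grassmannian A (A ⊗[R] M) k) :
    plucker N ∈ chart R (⋀[R]^k M) 1 (fun _ => exteriorPower.ιMulti R k x) A ↔ N ∈ chart R M k x A := by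
  rw [mem_chart_iff_forall_residueField, mem_chart_iff_forall_residueField]
  refine forall_congr' fun p => ?_
  rw [map_plucker, plucker_mem_chart_iff_of_field]

end Grassmannian

end Literature.AlgebraicGeometry.Motives

end
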